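import Literature.AnabelianGeometry.SemiGraphs.ArithMaximalCompact
import HarnessLib

/-!
# [SemiAnbd] §5: the trivial subgroup is not arithmetically ample (`Π_A` is not discrete)

Mochizuki, *Semi-graphs of anabelioids*, Publ. RIMS **42** (2006), §5, Def 5.3 (i) p. 65
[cite: MochizukiSemiAnbd2006, Def 5.3 (i), p. 65]: a closed subgroup of `Π^temp_𝔊` is
arithmetically ample if it surjects onto an OPEN subgroup of `Π_A = π̂₁(A)`.  In print `A` is a
connected noetherian scheme (Def 5.1) and in every application (Example 5.6, [IUTchI] §2) `Π_A` is
an infinite profinite group, so `{1}` is not open and the trivial subgroup is NOT arithmetically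
ample.  The Thm 5.4 assemblies of the abc-iut cell (sub-DAG Thm54: abc-iut-w4-d059's
`hstar_of_isArithAmple`, abc-iut-w4-d053's `ArithLevelData.arithMaximalCompactStatementI_of` /
`…II_of`) carry this as the explicit binder `hbot : ¬ IsArithAmple aug ⊥` (abc-iut-w4-d059's
observation O-T54-3: without it the typed Thm 5.4 (i) fails for discrete `Π_A`).  PROOF-ONLY file
(abc-iut-w4-d098): `hbot` discharged BY NAME from "`Π_A` is not discrete", in particular from
"`Π_A` is compact and infinite".  Nothing here bears on [IUTchIII] Cor. 3.12.
-/

namespace Literature.AnabelianGeometry.SemiGraphs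

universe u u'

variable {Gtp : Type u} [Group Gtp] {PA : Type u'} [Group PA] [TopologicalSpace PA]

/-- Arithmetic ampleness of the trivial subgroup says exactly that `{1}` is open in `Π_A`.
[cite: MochizukiSemiAnbd2006, Def 5.3 (i), p. 65] -/
theorem isArithAmple_bot_iff (aug : Gtp →* PA) :
    IsArithAmple aug (⊥ : Subgroup Gtp) ↔ IsOpen ({1} : Set PA) := by
  unfold IsArithAmple
  rw [Subgroup.map_bot, Subgroup.coe_bot]

/-- **`⊥` is not arithmetically ample when `Π_A` is not discrete** (the binder `hbot` of the Thm 5.4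
assemblies). [cite: MochizukiSemiAnbd2006, Def 5.3 (i), p. 65] -/
theorem not_isArithAmple_bot [ContinuousMul PA] (aug : Gtp →* PA) (hPA : ¬ DiscreteTopology PA) :
    ¬ IsArithAmple aug (⊥ : Subgroup Gtp) := fun h =>
  hPA (discreteTopology_of_isOpen_singleton_one ((isArithAmple_bot_iff aug).1 h))

omit [Group PA] in
/-- An infinite compact space is not discrete. [folklore] -/
private theorem not_discreteTopology_of_compactSpace_of_infinite [CompactSpace PA] [Infinite PA] :
    ¬ DiscreteTopology PA := fun _ => by
  haveI : Finite PA := finite_of_compact_of_discrete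
  exact not_finite PA

/-- **`⊥` is not arithmetically ample when `Π_A` is compact and infinite** — the case of print
(`Π_A = π̂₁(A)` an infinite profinite group; e.g. the absolute Galois group of a `p`-adic local
field in Example 5.6 / [IUTchI] §2). [cite: MochizukiSemiAnbd2006, Def 5.3 (i), p. 65] -/
theorem not_isArithAmple_bot_of_compactSpace [ContinuousMul PA] [CompactSpace PA] [Infinite PA]
    (aug : Gtp →* PA) : ¬ IsArithAmple aug (⊥ : Subgroup Gtp) :=
  not_isArithAmple_bot aug not_discreteTopology_of_compactSpace_of_infinite

/-- Conversely, over a DISCRETE `Π_A` every subgroup is arithmetically ample (so `hbot` cannot be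
dropped from the Thm 5.4 assemblies: abc-iut-w4-d059's O-T54-3).
[cite: MochizukiSemiAnbd2006, Def 5.3 (i), p. 65] -/
theorem isArithAmple_of_discreteTopology [DiscreteTopology PA] (aug : Gtp →* PA)
    (K : Subgroup Gtp) :
    IsArithAmple aug K :=
  isOpen_discrete _

end Literature.AnabelianGeometry.SemiGraphs
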